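import Literature.Probability.Percolation.TriUQuadBand
import HarnessLib

/-!
# Corridors from a fence to the real line: the six band routes

Topic `Literature/Probability/Percolation`; family `crit-perc`, statement **crit-perc.S16**
(`Literature.Probability.Percolation.triTheta_exponent`). The deterministic "extension inside the
free space" of Kesten's arm separation for the U-shaped half-plane region (P. Nolin, EJP 13
(2008), §4.3 Lemma 12 and §4.5, proof of Prop. 17 [arXiv 0711.4948: Lemma 11, Prop. 16]),
combining the band of `TriUQuadBand.lean` with a fence of `TriUQuadFences.lean`: for each side of
the inner arc carrying the tip and each foot of the band (left or right real segment of the inner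
half-box), the **corridor event** — open long-way crossings of at most three rectangles of the
band — links the fence to a real point `x` of the inner half-box, which is then joined to the
crossing `S` by an `ω`-open path of `U ∪ I`.

* `corrTopRight k W xs`, `corrTopLeft k W xe` — top band from column `xs` to the right corner and
  down the right leg / from the left corner to column `xe` and down the left leg.
* `corrLegLeft k W re`, `corrLegRight k W re` — a leg from the floor up to row `re`.
* `corrAroundLeft k W rs`, `corrAroundRight k W rs` — up a leg from row `rs`, along the whole top
  band, down the other leg.
* `realPoint_of_fenceV_topRight`, `realPoint_of_fenceV_topLeft` (vertical fences of top-side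
  tips), `realPoint_of_fenceH_legLeft`, `realPoint_of_fenceH_aroundLeft` (horizontal fences of
  left-side tips), `realPoint_of_fenceH_legRight`, `realPoint_of_fenceH_aroundRight` (right-side
  tips): fence + corridor ⇒ a real point of `I` joined to `S`.

## References

* P. Nolin, Near-critical percolation in two dimensions, *Electron. J. Probab.* 13 (2008), §4.3
  Lemma 12, §4.5 proof of Prop. 17 [arXiv 0711.4948: Lemma 11, Prop. 16] [Nolin2008].
* H. Kesten, Scaling relations for 2D-percolation, *Comm. Math. Phys.* 109 (1987), Lemma 4,
  (2.41)–(2.42) [KestenScalingCMP1987].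

## Mathlib / tree

Tree: `hCrossZ`, `vCrossZ`, `boxZ`, `joinedDown`, `joinedDown_of_vCrossZ_floor`,
`joinedDown_of_hCrossZ_meets`, `joinedDown_of_vCrossZ_meets`, `joinedDown_fenceV`,
`joinedDown_fenceH`, `exists_realPoint_of_joinedDown` (`TriUQuadBand.lean`), `uInner`, `uSites`.
-/

noncomputable section

open Set

namespace Literature.Probability.Percolation

open LatticeModels

/-! ### The corridor events -/

/-- **Top band to the right foot**: open horizontal crossing of `[xs, k-1] × [k-2W, k-W-1]` and
open vertical crossing of the right leg `[k-W, k-1] × [0, k-W-1]`. [cite: Nolin2008, §4.5, proof of Prop. 17 (arXiv 0711.4948: Prop. 16)] -/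
def corrTopRight (k W : ℕ) (xs : ℤ) : Set (Set (Site 2)) :=
  hCrossZ xs ((k : ℤ) - 1) ((k : ℤ) - 2 * W) ((k : ℤ) - W - 1) ∩
    vCrossZ ((k : ℤ) - W) ((k : ℤ) - 1) 0 ((k : ℤ) - W - 1)

/-- **Top band to the left foot**: open horizontal crossing of `[-k+1, xe] × [k-2W, k-W-1]` and
open vertical crossing of the left leg `[-k+1, -k+W] × [0, k-W-1]`. [cite: Nolin2008, §4.5, proof of Prop. 17 (arXiv 0711.4948: Prop. 16)] -/
def corrTopLeft (k W : ℕ) (xe : ℤ) : Set (Set (Site 2)) :=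
  hCrossZ (-(k : ℤ) + 1) xe ((k : ℤ) - 2 * W) ((k : ℤ) - W - 1) ∩
    vCrossZ (-(k : ℤ) + 1) (-(k : ℤ) + W) 0 ((k : ℤ) - W - 1)

/-- **Left leg from the floor to row `re`.** [cite: Nolin2008, §4.5, proof of Prop. 17 (arXiv 0711.4948: Prop. 16)] -/
def corrLegLeft (k W : ℕ) (re : ℤ) : Set (Set (Site 2)) :=
  vCrossZ (-(k : ℤ) + 1) (-(k : ℤ) + W) 0 re

/-- **Right leg from the floor to row `re`.** [cite: Nolin2008, §4.5, proof of Prop. 17 (arXiv 0711.4948: Prop. 16)] -/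
def corrLegRight (k W : ℕ) (re : ℤ) : Set (Set (Site 2)) :=
  vCrossZ ((k : ℤ) - W) ((k : ℤ) - 1) 0 re

/-- **Around from the left leg to the right foot**: up the left leg from row `rs`, along the whole
top band, down the right leg. [cite: Nolin2008, §4.5, proof of Prop. 17 (arXiv 0711.4948: Prop. 16)] -/
def corrAroundLeft (k W : ℕ) (rs : ℤ) : Set (Set (Site 2)) :=
  vCrossZ (-(k : ℤ) + 1) (-(k : ℤ) + W) rs ((k : ℤ) - W - 1) ∩ corrTopRight k W (-(k : ℤ) + 1)

/-- **Around from the right leg to the left foot.** [cite: Nolin2008, §4.5, proof of Prop. 17 (arXiv 0711.4948: Prop. 16)] -/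
def corrAroundRight (k W : ℕ) (rs : ℤ) : Set (Set (Site 2)) :=
  vCrossZ ((k : ℤ) - W) ((k : ℤ) - 1) rs ((k : ℤ) - W - 1) ∩ corrTopLeft k W ((k : ℤ) - 1)

/-! ### Fence + corridor ⇒ a real point joined to `S` -/

section Routes

variable {k N W : ℕ} {ω S X : Set (Site 2)} {a b : Site 2}

/-- The right leg stands in `I` and is joined down. [folklore] -/
theorem joinedDown_rightLeg (hW : 1 ≤ W) (hWk : 2 * W + 1 ≤ k) {re : ℤ} (hre : re ≤ (k : ℤ) - 1)
    (h : ω ∈ vCrossZ ((k : ℤ) - W) ((k : ℤ) - 1) 0 re) :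
    ∃ (T : Set (Site 2)) (e f : Site 2), T ⊆ boxZ ((k : ℤ) - W) ((k : ℤ) - 1) 0 re ∩ ω ∧
      PathIn triGraph T e f ∧ e 1 = 0 ∧ f 1 = re ∧ (∀ z ∈ T, PathIn triGraph T e z) ∧
      ∀ z ∈ T, z ∈ joinedDown k ω := by
  have hW' : (1 : ℤ) ≤ W := by exact_mod_cast hW
  have hWk' : 2 * (W : ℤ) + 1 ≤ k := by exact_mod_cast hWk
  refine joinedDown_of_vCrossZ_floor (fun z hz => ?_) h
  rw [mem_boxZ] at hz; rw [mem_uInner]; omega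

/-- The left leg stands in `I` and is joined down. [folklore] -/
theorem joinedDown_leftLeg (hW : 1 ≤ W) (hWk : 2 * W + 1 ≤ k) {re : ℤ} (hre : re ≤ (k : ℤ) - 1)
    (h : ω ∈ vCrossZ (-(k : ℤ) + 1) (-(k : ℤ) + W) 0 re) :
    ∃ (T : Set (Site 2)) (e f : Site 2), T ⊆ boxZ (-(k : ℤ) + 1) (-(k : ℤ) + W) 0 re ∩ ω ∧
      PathIn triGraph T e f ∧ e 1 = 0 ∧ f 1 = re ∧ (∀ z ∈ T, PathIn triGraph T e z) ∧
      ∀ z ∈ T, z ∈ joinedDown k ω := by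
  have hW' : (1 : ℤ) ≤ W := by exact_mod_cast hW
  have hWk' : 2 * (W : ℤ) + 1 ≤ k := by exact_mod_cast hWk
  refine joinedDown_of_vCrossZ_floor (fun z hz => ?_) h
  rw [mem_boxZ] at hz; rw [mem_uInner]; omega

/-- The top band from column `xs`, running into the right leg, is joined down. [folklore] -/
theorem joinedDown_topRight (hW : 1 ≤ W) (hWk : 2 * W + 1 ≤ k) {xs : ℤ} (hxs : -(k : ℤ) + 1 ≤ xs)
    (hxs' : xs ≤ (k : ℤ) - W) (h : ω ∈ corrTopRight k W xs) :
    ∃ (T : Set (Site 2)) (c d : Site 2),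
      T ⊆ boxZ xs ((k : ℤ) - 1) ((k : ℤ) - 2 * W) ((k : ℤ) - W - 1) ∩ ω ∧
      PathIn triGraph T c d ∧ c 0 = xs ∧ d 0 = (k : ℤ) - 1 ∧ (∀ z ∈ T, PathIn triGraph T c z) ∧
      ∀ z ∈ T, z ∈ joinedDown k ω := by
  have hW' : (1 : ℤ) ≤ W := by exact_mod_cast hW
  have hWk' : 2 * (W : ℤ) + 1 ≤ k := by exact_mod_cast hWk
  obtain ⟨hH, hV⟩ := h
  obtain ⟨TV, e, f, hTV, hpV, he, hf, -, hjV⟩ := joinedDown_rightLeg hW hWk (by omega) hV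
  exact joinedDown_of_hCrossZ_meets (fun z hz => mem_boxZ.1 (hTV hz).1) hpV he hf hjV
    (fun z hz => by rw [mem_boxZ] at hz; rw [mem_uInner]; omega) hH
    hxs' (by omega) le_rfl (by omega) (by omega) le_rfl

/-- The top band up to column `xe`, running into the left leg, is joined down. [folklore] -/
theorem joinedDown_topLeft (hW : 1 ≤ W) (hWk : 2 * W + 1 ≤ k) {xe : ℤ} (hxe : -(k : ℤ) + W ≤ xe)
    (hxe' : xe ≤ (k : ℤ) - 1) (h : ω ∈ corrTopLeft k W xe) :
    ∃ (T : Set (Site 2)) (c d : Site 2),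
      T ⊆ boxZ (-(k : ℤ) + 1) xe ((k : ℤ) - 2 * W) ((k : ℤ) - W - 1) ∩ ω ∧
      PathIn triGraph T c d ∧ c 0 = -(k : ℤ) + 1 ∧ d 0 = xe ∧ (∀ z ∈ T, PathIn triGraph T c z) ∧
      ∀ z ∈ T, z ∈ joinedDown k ω := by
  have hW' : (1 : ℤ) ≤ W := by exact_mod_cast hW
  have hWk' : 2 * (W : ℤ) + 1 ≤ k := by exact_mod_cast hWk
  obtain ⟨hH, hV⟩ := h
  obtain ⟨TV, e, f, hTV, hpV, he, hf, -, hjV⟩ := joinedDown_leftLeg hW hWk (by omega) hV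
  exact joinedDown_of_hCrossZ_meets (fun z hz => mem_boxZ.1 (hTV hz).1) hpV he hf hjV
    (fun z hz => by rw [mem_boxZ] at hz; rw [mem_uInner]; omega) hH
    le_rfl (by omega) hxe (by omega) (by omega) le_rfl

/-- **Vertical fence, top band to the right foot.** A fence `X ⊆ I ∩ ω`, tight support of a
top–bottom path of `[x₁, x₂] × [ρ, k-1]` from its base `a` (`ρ ≤ k - 2W`, `xs ≤ x₁ ≤ x₂ ≤ k-1`,
`xs ≤ k - W`),
whose base is joined to `S`, together with the corridor `corrTopRight k W xs`, gives a real point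
of `I` joined to a site of `S` by an `ω`-open path of `U ∪ I`. [cite: Nolin2008, §4.3 Lemma 12, §4.5 proof of Prop. 17 (arXiv 0711.4948: Lemma 11, Prop. 16)] -/
theorem realPoint_of_fenceV_topRight (hW : 1 ≤ W) (hWk : 2 * W + 1 ≤ k) {xs x₁ x₂ ρ : ℤ}
    (hxs : -(k : ℤ) + 1 ≤ xs) (hxsW : xs ≤ (k : ℤ) - W) (hx₁ : xs ≤ x₁) (hx₁₂ : x₁ ≤ x₂)
    (hx₂ : x₂ ≤ (k : ℤ) - 1)
    (hρ : ρ ≤ (k : ℤ) - 2 * W)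
    (hX : X ⊆ uInner k ∩ ω) (bX : ∀ v ∈ X, x₁ ≤ v 0 ∧ v 0 ≤ x₂ ∧ ρ ≤ v 1 ∧ v 1 ≤ (k : ℤ) - 1)
    (hab : PathIn triGraph X a b) (ha : a 1 = ρ) (hb : b 1 = (k : ℤ) - 1)
    (htight : ∀ v ∈ X, PathIn triGraph X a v)
    (hjoin : ∃ g ∈ S, PathIn triGraph (ω ∩ (↑(uSites k N) ∪ uInner k)) a g)
    (hcorr : ω ∈ corrTopRight k W xs) :
    ∃ x : Site 2, x 1 = 0 ∧ -(k : ℤ) + 1 ≤ x 0 ∧ x 0 ≤ k - 1 ∧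
      ∃ g ∈ S, PathIn triGraph (ω ∩ (↑(uSites k N) ∪ uInner k)) x g := by
  have hW' : (1 : ℤ) ≤ W := by exact_mod_cast hW
  have hWk' : 2 * (W : ℤ) + 1 ≤ k := by exact_mod_cast hWk
  obtain ⟨TH, c, d, hTH, hpH, hc, hd, -, hjH⟩ := joinedDown_topRight hW hWk hxs hxsW hcorr
  refine exists_realPoint_of_joinedDown ?_ hjoin
  exact joinedDown_fenceV (fun z hz => mem_boxZ.1 (hTH hz).1) hpH hc hd hjH hX bX hab ha hb htight
    hx₁ hx₁₂ hx₂ hρ (by omega) (by omega)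

/-- **Vertical fence, top band to the left foot** (`-k+1 ≤ x₁ ≤ x₂ ≤ xe ≤ k-1`, `xe ≥ -k+W`). [cite: Nolin2008, §4.3 Lemma 12, §4.5 proof of Prop. 17 (arXiv 0711.4948: Lemma 11, Prop. 16)] -/
theorem realPoint_of_fenceV_topLeft (hW : 1 ≤ W) (hWk : 2 * W + 1 ≤ k) {xe x₁ x₂ ρ : ℤ}
    (hxe : xe ≤ (k : ℤ) - 1) (hxeW : -(k : ℤ) + W ≤ xe) (hx₁ : -(k : ℤ) + 1 ≤ x₁) (hx₁₂ : x₁ ≤ x₂)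
    (hx₂ : x₂ ≤ xe) (hρ : ρ ≤ (k : ℤ) - 2 * W)
    (hX : X ⊆ uInner k ∩ ω) (bX : ∀ v ∈ X, x₁ ≤ v 0 ∧ v 0 ≤ x₂ ∧ ρ ≤ v 1 ∧ v 1 ≤ (k : ℤ) - 1)
    (hab : PathIn triGraph X a b) (ha : a 1 = ρ) (hb : b 1 = (k : ℤ) - 1)
    (htight : ∀ v ∈ X, PathIn triGraph X a v)
    (hjoin : ∃ g ∈ S, PathIn triGraph (ω ∩ (↑(uSites k N) ∪ uInner k)) a g)
    (hcorr : ω ∈ corrTopLeft k W xe) :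
    ∃ x : Site 2, x 1 = 0 ∧ -(k : ℤ) + 1 ≤ x 0 ∧ x 0 ≤ k - 1 ∧
      ∃ g ∈ S, PathIn triGraph (ω ∩ (↑(uSites k N) ∪ uInner k)) x g := by
  have hW' : (1 : ℤ) ≤ W := by exact_mod_cast hW
  have hWk' : 2 * (W : ℤ) + 1 ≤ k := by exact_mod_cast hWk
  obtain ⟨TH, c, d, hTH, hpH, hc, hd, -, hjH⟩ := joinedDown_topLeft hW hWk hxeW hxe hcorr
  refine exists_realPoint_of_joinedDown ?_ hjoin
  exact joinedDown_fenceV (fun z hz => mem_boxZ.1 (hTH hz).1) hpH hc hd hjH hX bX hab ha hb htight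
    hx₁ hx₁₂ hx₂ hρ (by omega) (by omega)

/-- **Horizontal fence on the left, left leg to the floor.** A fence `X ⊆ I ∩ ω`, tight support of
a left–right path of `[-k+1, x₂] × [ρ₁, ρ₂]` from its base `a` (`x₂ ≥ -k+W`,
`0 ≤ ρ₁ ≤ ρ₂ ≤ re ≤ k-1`), base joined to `S`, with the corridor `corrLegLeft k W re`, gives a real
point of `I` joined to `S`. [cite: Nolin2008, §4.3 Lemma 12, §4.5 proof of Prop. 17 (arXiv 0711.4948: Lemma 11, Prop. 16)] -/
theorem realPoint_of_fenceH_legLeft (hW : 1 ≤ W) (hWk : 2 * W + 1 ≤ k) {re x₂ ρ₁ ρ₂ : ℤ}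
    (hre : re ≤ (k : ℤ) - 1) (hx₂ : -(k : ℤ) + W ≤ x₂) (hρ₁ : 0 ≤ ρ₁) (hρ₁₂ : ρ₁ ≤ ρ₂) (hρ₂ : ρ₂ ≤ re)
    (hX : X ⊆ uInner k ∩ ω)
    (bX : ∀ v ∈ X, -(k : ℤ) + 1 ≤ v 0 ∧ v 0 ≤ x₂ ∧ ρ₁ ≤ v 1 ∧ v 1 ≤ ρ₂)
    (hab : PathIn triGraph X a b) (ha : a 0 = -(k : ℤ) + 1) (hb : b 0 = x₂)
    (htight : ∀ v ∈ X, PathIn triGraph X a v)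
    (hjoin : ∃ g ∈ S, PathIn triGraph (ω ∩ (↑(uSites k N) ∪ uInner k)) a g)
    (hcorr : ω ∈ corrLegLeft k W re) :
    ∃ x : Site 2, x 1 = 0 ∧ -(k : ℤ) + 1 ≤ x 0 ∧ x 0 ≤ k - 1 ∧
      ∃ g ∈ S, PathIn triGraph (ω ∩ (↑(uSites k N) ∪ uInner k)) x g := by
  have hW' : (1 : ℤ) ≤ W := by exact_mod_cast hW
  obtain ⟨TV, e, f, hTV, hpV, he, hf, -, hjV⟩ := joinedDown_leftLeg hW hWk hre hcorr
  refine exists_realPoint_of_joinedDown ?_ hjoin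
  exact joinedDown_fenceH (fun z hz => mem_boxZ.1 (hTV hz).1) hpV he hf hjV hX bX hab ha hb htight
    le_rfl (by omega) hx₂ hρ₁ hρ₁₂ hρ₂

/-- **Horizontal fence on the left, around to the right foot** (`rs ≤ ρ₁ ≤ ρ₂ ≤ k-W-1`,
`rs ≤ k-2W`, `0 ≤ rs`). [cite: Nolin2008, §4.3 Lemma 12, §4.5 proof of Prop. 17 (arXiv 0711.4948: Lemma 11, Prop. 16)] -/
theorem realPoint_of_fenceH_aroundLeft (hW : 1 ≤ W) (hWk : 2 * W + 1 ≤ k) {rs x₂ ρ₁ ρ₂ : ℤ}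
    (hrs : 0 ≤ rs) (hrsW : rs ≤ (k : ℤ) - 2 * W) (hx₂ : -(k : ℤ) + W ≤ x₂) (hρ₁ : rs ≤ ρ₁)
    (hρ₁₂ : ρ₁ ≤ ρ₂) (hρ₂ : ρ₂ ≤ (k : ℤ) - W - 1)
    (hX : X ⊆ uInner k ∩ ω)
    (bX : ∀ v ∈ X, -(k : ℤ) + 1 ≤ v 0 ∧ v 0 ≤ x₂ ∧ ρ₁ ≤ v 1 ∧ v 1 ≤ ρ₂)
    (hab : PathIn triGraph X a b) (ha : a 0 = -(k : ℤ) + 1) (hb : b 0 = x₂)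
    (htight : ∀ v ∈ X, PathIn triGraph X a v)
    (hjoin : ∃ g ∈ S, PathIn triGraph (ω ∩ (↑(uSites k N) ∪ uInner k)) a g)
    (hcorr : ω ∈ corrAroundLeft k W rs) :
    ∃ x : Site 2, x 1 = 0 ∧ -(k : ℤ) + 1 ≤ x 0 ∧ x 0 ≤ k - 1 ∧
      ∃ g ∈ S, PathIn triGraph (ω ∩ (↑(uSites k N) ∪ uInner k)) x g := by
  have hW' : (1 : ℤ) ≤ W := by exact_mod_cast hW
  have hWk' : 2 * (W : ℤ) + 1 ≤ k := by exact_mod_cast hWk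
  obtain ⟨hVL, hTR⟩ := hcorr
  obtain ⟨TH, c, d, hTH, hpH, hc, hd, -, hjH⟩ := joinedDown_topRight hW hWk le_rfl (by omega) hTR
  obtain ⟨TV, e, f, hTV, hpV, he, hf, -, hjV⟩ := joinedDown_of_vCrossZ_meets
    (fun z hz => mem_boxZ.1 (hTH hz).1) hpH hc hd hjH
    (fun z hz => by rw [mem_boxZ] at hz; rw [mem_uInner]; omega) hVL
    le_rfl (by omega) (by omega) hrsW (by omega) le_rfl
  refine exists_realPoint_of_joinedDown ?_ hjoin
  exact joinedDown_fenceH (fun z hz => mem_boxZ.1 (hTV hz).1) hpV he hf hjV hX bX hab ha hb htight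
    le_rfl (by omega) hx₂ hρ₁ hρ₁₂ hρ₂

/-- **Horizontal fence on the right, right leg to the floor** (`x₁ ≤ k-W`,
`0 ≤ ρ₁ ≤ ρ₂ ≤ re ≤ k-1`). [cite: Nolin2008, §4.3 Lemma 12, §4.5 proof of Prop. 17 (arXiv 0711.4948: Lemma 11, Prop. 16)] -/
theorem realPoint_of_fenceH_legRight (hW : 1 ≤ W) (hWk : 2 * W + 1 ≤ k) {re x₁ ρ₁ ρ₂ : ℤ}
    (hre : re ≤ (k : ℤ) - 1) (hx₁ : x₁ ≤ (k : ℤ) - W) (hρ₁ : 0 ≤ ρ₁) (hρ₁₂ : ρ₁ ≤ ρ₂) (hρ₂ : ρ₂ ≤ re)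
    (hX : X ⊆ uInner k ∩ ω)
    (bX : ∀ v ∈ X, x₁ ≤ v 0 ∧ v 0 ≤ (k : ℤ) - 1 ∧ ρ₁ ≤ v 1 ∧ v 1 ≤ ρ₂)
    (hab : PathIn triGraph X a b) (ha : a 0 = x₁) (hb : b 0 = (k : ℤ) - 1)
    (htight : ∀ v ∈ X, PathIn triGraph X a v)
    (hjoin : ∃ g ∈ S, PathIn triGraph (ω ∩ (↑(uSites k N) ∪ uInner k)) a g)
    (hcorr : ω ∈ corrLegRight k W re) :
    ∃ x : Site 2, x 1 = 0 ∧ -(k : ℤ) + 1 ≤ x 0 ∧ x 0 ≤ k - 1 ∧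
      ∃ g ∈ S, PathIn triGraph (ω ∩ (↑(uSites k N) ∪ uInner k)) x g := by
  have hW' : (1 : ℤ) ≤ W := by exact_mod_cast hW
  obtain ⟨TV, e, f, hTV, hpV, he, hf, -, hjV⟩ := joinedDown_rightLeg hW hWk hre hcorr
  refine exists_realPoint_of_joinedDown ?_ hjoin
  exact joinedDown_fenceH (fun z hz => mem_boxZ.1 (hTV hz).1) hpV he hf hjV hX bX hab ha hb htight
    hx₁ (by omega) le_rfl hρ₁ hρ₁₂ hρ₂

/-- **Horizontal fence on the right, around to the left foot** (`rs ≤ ρ₁ ≤ ρ₂ ≤ k-W-1`,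
`rs ≤ k-2W`, `0 ≤ rs`, `x₁ ≤ k-W`). [cite: Nolin2008, §4.3 Lemma 12, §4.5 proof of Prop. 17 (arXiv 0711.4948: Lemma 11, Prop. 16)] -/
theorem realPoint_of_fenceH_aroundRight (hW : 1 ≤ W) (hWk : 2 * W + 1 ≤ k) {rs x₁ ρ₁ ρ₂ : ℤ}
    (hrs : 0 ≤ rs) (hrsW : rs ≤ (k : ℤ) - 2 * W) (hx₁ : x₁ ≤ (k : ℤ) - W) (hρ₁ : rs ≤ ρ₁)
    (hρ₁₂ : ρ₁ ≤ ρ₂) (hρ₂ : ρ₂ ≤ (k : ℤ) - W - 1)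
    (hX : X ⊆ uInner k ∩ ω)
    (bX : ∀ v ∈ X, x₁ ≤ v 0 ∧ v 0 ≤ (k : ℤ) - 1 ∧ ρ₁ ≤ v 1 ∧ v 1 ≤ ρ₂)
    (hab : PathIn triGraph X a b) (ha : a 0 = x₁) (hb : b 0 = (k : ℤ) - 1)
    (htight : ∀ v ∈ X, PathIn triGraph X a v)
    (hjoin : ∃ g ∈ S, PathIn triGraph (ω ∩ (↑(uSites k N) ∪ uInner k)) a g)
    (hcorr : ω ∈ corrAroundRight k W rs) :
    ∃ x : Site 2, x 1 = 0 ∧ -(k : ℤ) + 1 ≤ x 0 ∧ x 0 ≤ k - 1 ∧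
      ∃ g ∈ S, PathIn triGraph (ω ∩ (↑(uSites k N) ∪ uInner k)) x g := by
  have hW' : (1 : ℤ) ≤ W := by exact_mod_cast hW
  have hWk' : 2 * (W : ℤ) + 1 ≤ k := by exact_mod_cast hWk
  obtain ⟨hVR, hTL⟩ := hcorr
  obtain ⟨TH, c, d, hTH, hpH, hc, hd, -, hjH⟩ := joinedDown_topLeft hW hWk (by omega) le_rfl hTL
  obtain ⟨TV, e, f, hTV, hpV, he, hf, -, hjV⟩ := joinedDown_of_vCrossZ_meets
    (fun z hz => mem_boxZ.1 (hTH hz).1) hpH hc hd hjH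
    (fun z hz => by rw [mem_boxZ] at hz; rw [mem_uInner]; omega) hVR
    (by omega) (by omega) le_rfl hrsW (by omega) le_rfl
  refine exists_realPoint_of_joinedDown ?_ hjoin
  exact joinedDown_fenceH (fun z hz => mem_boxZ.1 (hTV hz).1) hpV he hf hjV hX bX hab ha hb htight
    hx₁ (by omega) le_rfl hρ₁ hρ₁₂ hρ₂

end Routes

end Literature.Probability.Percolation
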